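import Mathlib
import Summits.ValiantsHypothesis.ValiantsHypothesis.Theorems.KPlusLogSqLawTropicalBMultiExchange
import Summits.ValiantsHypothesis.ValiantsHypothesis.Theorems.KPlusLogSqLawTropicalBNoReturn

/-!
# Route «KPlusLogSqLaw», crux `TropicalB` (stmt-ValiantsHypothesis-19771) — the NO-RETURN LAW for rotation registers of EVEN length

HONEST FRAMING.  Helper file (cell `pub-symmetroid`, seat val-sym-trop-p1 g31, 2026-08-29) `--supports` the crux
`Summit.ValiantsHypothesis.ValiantsHypothesis.Theses.KPlusLogSqLaw.TropicalB` (item `stmt-ValiantsHypothesis-19771`).  Companion of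
`…TropicalBNoReturn` (odd length); a STRUCTURE law valid in every design of every format, an instance of `MultiExchange.prefix_deficit`
(val-sym-trop-p4 g5).  Def-free.  Nothing here bounds `TropicalB`; nothing bears on `WeakLifting`, the doors, `MatrixDescartes` (18050) or VP ≠ VNP.

THE PATTERN (ring of even length `p = 2k + 4`; support `t₀, …, t_{k+2}` = the odd columns `c₁, …, c_{p−3}` (`t_i = c_{2i+1}`, `i ≤ k`), then
`t_{k+1} = c_{p−2}`, `t_{k+2} = c_{p−1}`; any `k + 3` distinct columns of any design).  `C` is HOME on the support (`h_i := C.1 t_i`); `B` is TWO STEPS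
OUT on the odd columns (`B.1 t₀ = h_{k+2}`, `B.1 t_{i+1} = h_i` for `i < k`, `B.1 t_{k+2} = h_k`; `B` arbitrary at `t_{k+1}`); `A` is ONE STEP OUT on the
last two (`A.1 t_{k+2} = h_{k+1}`, `A.1 t_{k+1} = B.1 t_{k+2}`); bookkeeping `d(C.2 t_{k+1}) + d(B.2 t_{k+2}) ≤ d(A.2 t_{k+1}) + d(A.2 t_{k+2})` and
`Σ_{i ≤ k+2} d(C.2 t_i) ≤ Σ_{i ≤ k} d(B.2 t_i) + d(A.2 t_{k+1}) + d(A.2 t_{k+2})`.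
* `NoReturnEven.no_return_even` — then `A`, `B`, `C` are never unique optima at slopes `θ_A ≤ θ_B ≤ θ_C`.  Hybrids: `qA = A ∘ (t_{k+1} t_{k+2})`,
  `qB = B ∘ τ` (`τ` the cyclic shift of `t₀, …, t_k, t_{k+2}`, skipping `t_{k+1}` where `qB = B`), `qC = C ∘ σ⁻¹` (`σ` the cyclic shift of the whole
  support); a Latin triple with prefix excesses `e_A ≥ 0`, `e_A + e_B ≥ 0`.
READING: with `NoReturn.no_return` this gives, for EVERY ring length `p ≥ 4`: a rotation register that was the unique optimum at offsets 1 and 2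
never shows its home configuration again, in any design (located origin: seat memo REUSE-g31.md §3c, certificates checked for `p = 4 … 20`).  [this seat]
-/

set_option linter.dupNamespace false
set_option autoImplicit false

namespace Summit.ValiantsHypothesis.ValiantsHypothesis.Theorems.KPlusLogSqLaw

open Summit.ValiantsHypothesis.ValiantsHypothesis.Theorems.MatrixDescartes.Negative
open Finset

namespace NoReturnEven

variable {m K : ℕ}

/-- **NO-RETURN LAW, even rings.**  See the module docstring. [this seat] -/
theorem no_return_even (d : Fin K → ℕ) (v ε : Fin m → Fin m → Fin K → ℤ) {k : ℕ}
    (t : Fin (k + 3) → Fin m) (ht : Function.Injective t)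
    (A B C : Equiv.Perm (Fin m) × (Fin m → Fin K)) {θA θB θC : ℤ} (hAB : θA ≤ θB) (hBC : θB ≤ θC)
    (hdA : IsDominant d v ε θA A) (hdB : IsDominant d v ε θB B) (hdC : IsDominant d v ε θC C)
    (hB0 : B.1 (t 0) = C.1 (t (Fin.last (k + 2))))
    (hBstep : ∀ i : Fin (k + 3), (i : ℕ) < k → B.1 (t (finRotate (k + 3) i)) = C.1 (t i))
    (hBk : B.1 (t (Fin.last (k + 2))) = C.1 (t ⟨k, by omega⟩))
    (hA1 : A.1 (t (Fin.last (k + 2))) = C.1 (t (Fin.last (k + 1)).castSucc))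
    (hA2 : B.1 (t (Fin.last (k + 2))) = A.1 (t (Fin.last (k + 1)).castSucc))
    (heA : d (C.2 (t (Fin.last (k + 1)).castSucc)) + d (B.2 (t (Fin.last (k + 2)))) ≤
      d (A.2 (t (Fin.last (k + 1)).castSucc)) + d (A.2 (t (Fin.last (k + 2)))))
    (heAB : ∑ i : Fin (k + 3), d (C.2 (t i)) ≤
      ∑ i : Fin (k + 1), d (B.2 (t i.castSucc.castSucc)) + d (A.2 (t (Fin.last (k + 1)).castSucc)) + d (A.2 (t (Fin.last (k + 2))))) :
    False := by
  classical
  set aa : Fin (k + 3) := (Fin.last (k + 1)).castSucc with haa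
  set ll : Fin (k + 3) := Fin.last (k + 2) with hll
  set kk : Fin (k + 3) := ⟨k, by omega⟩ with hkk
  have haa_val : (aa : ℕ) = k + 1 := by simp [haa]
  have hll_val : (ll : ℕ) = k + 2 := by simp [hll]
  have hal : aa ≠ ll := by intro h; have := congrArg Fin.val h; omega
  have h0l : (0 : Fin (k + 3)) ≠ ll := by intro h; have := congrArg Fin.val h; simp [hll_val] at this
  have h0a : (0 : Fin (k + 3)) ≠ aa := by intro h; have := congrArg Fin.val h; simp [haa_val] at this
  have hrot_kk : finRotate (k + 3) kk = aa := by
    rw [hkk]; ext; rw [finRotate_of_lt (by omega)]; simp [haa_val]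
  have hrot_aa : finRotate (k + 3) aa = ll := by
    ext; rw [show aa = ⟨k + 1, by omega⟩ from Fin.ext (by simp [haa_val]), finRotate_of_lt (by omega)]; simp [hll_val]
  have hrot_ll : finRotate (k + 3) ll = 0 := by rw [hll]; exact finRotate_last
  have htinj : ∀ {i j : Fin (k + 3)}, t i = t j ↔ i = j := fun {i j} => ht.eq_iff
  -- the shortened support `t'` (all support columns but `t aa`), in the order `t 0, …, t k, t ll`
  let t' : Fin (k + 2) → Fin m := fun j => if j = Fin.last (k + 1) then t ll else t ⟨j, by omega⟩
  have t'_last : t' (Fin.last (k + 1)) = t ll := by simp [t']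
  have t'_cast : ∀ j : Fin (k + 2), (j : ℕ) ≤ k → t' j = t ⟨j, by omega⟩ := by
    intro j hj
    have : j ≠ Fin.last (k + 1) := by intro h; have := congrArg Fin.val h; simp at this; omega
    simp [t', this]
  have val_le : ∀ j : Fin (k + 2), j ≠ Fin.last (k + 1) → (j : ℕ) ≤ k := by
    intro j hj; have := j.isLt; have : (j : ℕ) ≠ k + 1 := fun h' => hj (Fin.ext (by simp [h'])); omega
  have t'_ne_aa : ∀ j, t' j ≠ t aa := by
    intro j h
    by_cases hj : j = Fin.last (k + 1)
    · rw [hj, t'_last] at h; exact hal.symm (htinj.mp h)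
    · rw [t'_cast j (val_le j hj)] at h
      have := congrArg Fin.val (htinj.mp h); have := val_le j hj; simp [haa_val] at *; omega
  have t'_ne_ll : ∀ j, j ≠ Fin.last (k + 1) → t' j ≠ t ll := by
    intro j hj h
    rw [t'_cast j (val_le j hj)] at h
    have := congrArg Fin.val (htinj.mp h); simp [hll_val] at this; omega
  have ht' : Function.Injective t' := by
    intro i j h
    by_cases hi : i = Fin.last (k + 1) <;> by_cases hj : j = Fin.last (k + 1)
    · rw [hi, hj]
    · exact absurd (by rw [← h, hi, t'_last]) (t'_ne_ll j hj)
    · exact absurd (by rw [h, hj, t'_last]) (t'_ne_ll i hi)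
    · rw [t'_cast i (val_le i hi), t'_cast j (val_le j hj)] at h
      exact Fin.ext (by have := congrArg Fin.val (htinj.mp h); simpa using this)
  have range_t'_sub : ∀ {b}, b ∈ Set.range t' → b ∈ Set.range t := by
    rintro b ⟨j, rfl⟩
    by_cases hj : j = Fin.last (k + 1)
    · rw [hj, t'_last]; exact ⟨ll, rfl⟩
    · rw [t'_cast j (val_le j hj)]; exact ⟨_, rfl⟩
  -- the two cyclic shifts and the three hybrids
  let σ : Equiv.Perm (Fin m) := (finRotate (k + 3)).extendDomain (Equiv.ofInjective t ht)
  have σ_apply : ∀ i, σ (t i) = t (finRotate (k + 3) i) := fun i => by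
    simpa [Equiv.ofInjective_apply] using (finRotate (k + 3)).extendDomain_apply_image (Equiv.ofInjective t ht) i
  have σ_not : ∀ {b : Fin m}, b ∉ Set.range t → σ b = b := fun {b} hb =>
    (finRotate (k + 3)).extendDomain_apply_not_subtype (Equiv.ofInjective t ht) hb
  have σ_symm_apply : ∀ i, σ.symm (t (finRotate (k + 3) i)) = t i := by
    intro i; rw [Equiv.symm_apply_eq]; exact (σ_apply i).symm
  have σ_symm_not : ∀ {b : Fin m}, b ∉ Set.range t → σ.symm b = b := by
    intro b hb; rw [Equiv.symm_apply_eq]; exact (σ_not hb).symm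
  let τ : Equiv.Perm (Fin m) := (finRotate (k + 2)).extendDomain (Equiv.ofInjective t' ht')
  have τ_apply : ∀ j, τ (t' j) = t' (finRotate (k + 2) j) := fun j => by
    simpa [Equiv.ofInjective_apply] using (finRotate (k + 2)).extendDomain_apply_image (Equiv.ofInjective t' ht') j
  have τ_not : ∀ {b : Fin m}, b ∉ Set.range t' → τ b = b := fun {b} hb =>
    (finRotate (k + 2)).extendDomain_apply_not_subtype (Equiv.ofInjective t' ht') hb
  let qA : Equiv.Perm (Fin m) × (Fin m → Fin K) :=
    ((Equiv.swap (t aa) (t ll)).trans A.1,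
      fun b => if b = t aa then C.2 b else if b = t ll then B.2 b else A.2 b)
  let qB : Equiv.Perm (Fin m) × (Fin m → Fin K) :=
    (τ.trans B.1, fun b => if b ∈ Set.range t' then C.2 b else B.2 b)
  let qC : Equiv.Perm (Fin m) × (Fin m → Fin K) :=
    (σ.symm.trans C.1, fun b => if b = t aa then A.2 b else if b = t ll then A.2 b else if b ∈ Set.range t then B.2 b else C.2 b)
  -- (a) off the support everything is the identity
  have offA : ∀ b, b ∉ Set.range t → (qA.1 b, qA.2 b) = (A.1 b, A.2 b) := by
    intro b hb
    have h1 : b ≠ t aa := fun h => hb ⟨aa, h.symm⟩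
    have h2 : b ≠ t ll := fun h => hb ⟨ll, h.symm⟩
    simp only [qA, Equiv.trans_apply, Equiv.swap_apply_of_ne_of_ne h1 h2, if_neg h1, if_neg h2]
  have offB : ∀ b, b ∉ Set.range t' → (qB.1 b, qB.2 b) = (B.1 b, B.2 b) := by
    intro b hb
    simp only [qB, Equiv.trans_apply, τ_not hb, if_neg hb]
  have offC : ∀ b, b ∉ Set.range t → (qC.1 b, qC.2 b) = (C.1 b, C.2 b) := by
    intro b hb
    have h1 : b ≠ t aa := fun h => hb ⟨aa, h.symm⟩
    have h2 : b ≠ t ll := fun h => hb ⟨ll, h.symm⟩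
    simp only [qC, Equiv.trans_apply, σ_symm_not hb, if_neg h1, if_neg h2, if_neg hb]
  -- (b) on the support
  have memT : ∀ i, t i ∈ Set.range t := fun i => ⟨i, rfl⟩
  have memT' : ∀ j, t' j ∈ Set.range t' := fun j => ⟨j, rfl⟩
  have qA_aa : (qA.1 (t aa), qA.2 (t aa)) = (C.1 (t aa), C.2 (t aa)) := by
    simp only [qA, Equiv.trans_apply, Equiv.swap_apply_left]
    simp [hA1]
  have qA_ll : (qA.1 (t ll), qA.2 (t ll)) = (B.1 (t ll), B.2 (t ll)) := by
    have h : t ll ≠ t aa := fun h => hal (htinj.mp h).symm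
    simp only [qA, Equiv.trans_apply, Equiv.swap_apply_right, if_neg h]
    simp [hA2]
  have qA_other : ∀ i, i ≠ aa → i ≠ ll → (qA.1 (t i), qA.2 (t i)) = (A.1 (t i), A.2 (t i)) := by
    intro i h1 h2
    have h1' : t i ≠ t aa := fun h => h1 (htinj.mp h)
    have h2' : t i ≠ t ll := fun h => h2 (htinj.mp h)
    simp only [qA, Equiv.trans_apply, Equiv.swap_apply_of_ne_of_ne h1' h2', if_neg h1', if_neg h2']
  -- `qB` on the shortened support: always `C`'s incidence
  have qB_t' : ∀ j, (qB.1 (t' j), qB.2 (t' j)) = (C.1 (t' j), C.2 (t' j)) := by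
    intro j
    simp only [qB, Equiv.trans_apply, τ_apply, if_pos (memT' j)]
    refine Prod.ext ?_ rfl
    show B.1 (t' (finRotate (k + 2) j)) = C.1 (t' j)
    by_cases hj : j = Fin.last (k + 1)
    · rw [hj, finRotate_last, t'_last, t'_cast 0 (by simp)]
      simpa using hB0
    · have hjv : (j : ℕ) ≤ k := val_le j hj
      have hrot : finRotate (k + 2) j = ⟨(j : ℕ) + 1, by omega⟩ :=
        Fin.ext (by rw [coe_finRotate_of_ne_last hj])
      rw [hrot, t'_cast j hjv]
      rcases Nat.lt_or_ge (j : ℕ) k with hlt | hge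
      · rw [t'_cast ⟨(j : ℕ) + 1, by omega⟩ (by simp; omega)]
        have h := hBstep ⟨(j : ℕ), by omega⟩ hlt
        have hrot3 : finRotate (k + 3) ⟨(j : ℕ), by omega⟩ = ⟨(j : ℕ) + 1, by omega⟩ := finRotate_of_lt (by omega)
        rw [hrot3] at h
        exact h
      · have hjk : (j : ℕ) = k := by omega
        have : (⟨(j : ℕ) + 1, by omega⟩ : Fin (k + 2)) = Fin.last (k + 1) := Fin.ext (by simp [hjk])
        rw [this, t'_last, hBk]
        congr 2; exact Fin.ext (by simp [hkk, hjk])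
  have qB_aa : (qB.1 (t aa), qB.2 (t aa)) = (B.1 (t aa), B.2 (t aa)) :=
    offB (t aa) (by rintro ⟨j, hj⟩; exact t'_ne_aa j hj)
  -- `qC` indexed as `t (finRotate j)`
  have qC_rot : ∀ j, (qC.1 (t (finRotate (k + 3) j)), qC.2 (t (finRotate (k + 3) j))) =
      (C.1 (t j), if t (finRotate (k + 3) j) = t aa then A.2 (t (finRotate (k + 3) j))
        else if t (finRotate (k + 3) j) = t ll then A.2 (t (finRotate (k + 3) j)) else B.2 (t (finRotate (k + 3) j))) := by
    intro j
    simp only [qC, Equiv.trans_apply, σ_symm_apply, if_pos (memT _)]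
  have qC_aa : (qC.1 (t aa), qC.2 (t aa)) = (A.1 (t aa), A.2 (t aa)) := by
    have h := qC_rot kk
    rw [hrot_kk] at h
    rw [h, if_pos rfl, ← hBk, hA2]
  have qC_ll : (qC.1 (t ll), qC.2 (t ll)) = (A.1 (t ll), A.2 (t ll)) := by
    have h := qC_rot aa
    rw [hrot_aa] at h
    have h' : t ll ≠ t aa := fun h => hal (htinj.mp h).symm
    rw [h, if_neg h', if_pos rfl, hA1]
  have qC_zero : (qC.1 (t 0), qC.2 (t 0)) = (B.1 (t 0), B.2 (t 0)) := by
    have h := qC_rot ll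
    rw [hrot_ll] at h
    have h1 : t 0 ≠ t aa := fun h => h0a (htinj.mp h)
    have h2 : t 0 ≠ t ll := fun h => h0l (htinj.mp h)
    rw [h, if_neg h1, if_neg h2, hB0]
  have qC_step : ∀ j : Fin (k + 3), (j : ℕ) < k →
      (qC.1 (t (finRotate (k + 3) j)), qC.2 (t (finRotate (k + 3) j))) =
        (B.1 (t (finRotate (k + 3) j)), B.2 (t (finRotate (k + 3) j))) := by
    intro j hj
    have h := qC_rot j
    have hv : ((finRotate (k + 3) j : Fin (k + 3)) : ℕ) = (j : ℕ) + 1 := by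
      have := finRotate_of_lt (n := k + 2) (k := j) (by omega)
      rw [show (⟨(j : ℕ), by omega⟩ : Fin (k + 3)) = j from Fin.ext rfl] at this
      rw [this]
    have hne1 : t (finRotate (k + 3) j) ≠ t aa := by
      intro h; have := congrArg Fin.val (htinj.mp h); rw [hv, haa_val] at this; omega
    have hne2 : t (finRotate (k + 3) j) ≠ t ll := by
      intro h; have := congrArg Fin.val (htinj.mp h); rw [hv, hll_val] at this; omega
    rw [h, if_neg hne1, if_neg hne2, hBstep j hj]
  -- the terms, indexed
  let P : ℕ → Equiv.Perm (Fin m) × (Fin m → Fin K) := fun j => if j = 0 then A else if j = 1 then B else C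
  let Q : ℕ → Equiv.Perm (Fin m) × (Fin m → Fin K) := fun j => if j = 0 then qA else if j = 1 then qB else qC
  let θ : ℕ → ℤ := fun j => if j = 0 then θA else if j = 1 then θB else θC
  have hP0 : P 0 = A := rfl; have hP1 : P 1 = B := rfl; have hP2 : P 2 = C := rfl
  have hQ0 : Q 0 = qA := rfl; have hQ1 : Q 1 = qB := rfl; have hQ2 : Q 2 = qC := rfl
  have hθ : ∀ i, i + 1 < 3 → θ i ≤ θ (i + 1) := by
    intro i hi; have hi2 : i < 2 := by omega
    interval_cases i <;> assumption
  have hdom : ∀ j, j < 3 → IsDominant d v ε (θ j) (P j) := by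
    intro j hj; interval_cases j <;> assumption
  have epsA := LacunarySymmetroidMatrixDescartes.TropicalCensus.present_of_termSign_ne_zero ε A hdA.1
  have epsB := LacunarySymmetroidMatrixDescartes.TropicalCensus.present_of_termSign_ne_zero ε B hdB.1
  have epsC := LacunarySymmetroidMatrixDescartes.TropicalCensus.present_of_termSign_ne_zero ε C hdC.1
  -- the column-by-column Latin structure
  have inc_cases : ∀ b, ((qA.1 b, qA.2 b) = (A.1 b, A.2 b) ∧ (qB.1 b, qB.2 b) = (B.1 b, B.2 b) ∧ (qC.1 b, qC.2 b) = (C.1 b, C.2 b)) ∨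
      ((qA.1 b, qA.2 b) = (C.1 b, C.2 b) ∧ (qB.1 b, qB.2 b) = (B.1 b, B.2 b) ∧ (qC.1 b, qC.2 b) = (A.1 b, A.2 b)) ∨
      ((qA.1 b, qA.2 b) = (B.1 b, B.2 b) ∧ (qB.1 b, qB.2 b) = (C.1 b, C.2 b) ∧ (qC.1 b, qC.2 b) = (A.1 b, A.2 b)) ∨
      ((qA.1 b, qA.2 b) = (A.1 b, A.2 b) ∧ (qB.1 b, qB.2 b) = (C.1 b, C.2 b) ∧ (qC.1 b, qC.2 b) = (B.1 b, B.2 b)) := by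
    intro b
    by_cases hb : b ∈ Set.range t
    · obtain ⟨i, rfl⟩ := hb
      by_cases h1 : i = aa
      · subst h1; right; left; exact ⟨qA_aa, qB_aa, qC_aa⟩
      by_cases h2 : i = ll
      · subst h2; right; right; left
        refine ⟨qA_ll, ?_, qC_ll⟩
        rw [← t'_last]; exact qB_t' _
      right; right; right
      have hiv : (i : ℕ) ≤ k := by
        have := i.isLt; have : (i : ℕ) ≠ k + 1 := fun h => h1 (Fin.ext (by simp [haa_val, h]))
        have : (i : ℕ) ≠ k + 2 := fun h => h2 (Fin.ext (by simp [hll_val, h])); omega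
      have hBi : (qB.1 (t i), qB.2 (t i)) = (C.1 (t i), C.2 (t i)) := by
        have := qB_t' ⟨(i : ℕ), by omega⟩
        rw [t'_cast _ (by simp; omega)] at this
        rw [show (⟨((⟨(i : ℕ), by omega⟩ : Fin (k + 2)) : ℕ), by omega⟩ : Fin (k + 3)) = i from Fin.ext rfl] at this
        exact this
      refine ⟨qA_other i h1 h2, hBi, ?_⟩
      by_cases h3 : i = 0
      · subst h3; exact qC_zero
      · have hi3 : (i : ℕ) ≠ 0 := fun h => h3 (Fin.ext (by simp [h]))
        have hji : finRotate (k + 3) ⟨(i : ℕ) - 1, by omega⟩ = i := by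
          rw [finRotate_of_lt (by omega)]; ext; simp; omega
        rw [← hji]; exact qC_step _ (by simp; omega)
    · left
      exact ⟨offA b hb, offB b (fun h => hb (range_t'_sub h)), offC b hb⟩
  have pres : ∀ (q X : Equiv.Perm (Fin m) × (Fin m → Fin K)) (b : Fin m),
      (q.1 b, q.2 b) = (X.1 b, X.2 b) → ε (X.1 b) b (X.2 b) ≠ 0 → ε (q.1 b) b (q.2 b) ≠ 0 := by
    intro q X b h hX; obtain ⟨h1, h2⟩ := Prod.mk.inj h; rw [h1, h2]; exact hX
  have presAll : ∀ (q : Equiv.Perm (Fin m) × (Fin m → Fin K)) (b : Fin m),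
      ((q.1 b, q.2 b) = (A.1 b, A.2 b) ∨ (q.1 b, q.2 b) = (B.1 b, B.2 b) ∨ (q.1 b, q.2 b) = (C.1 b, C.2 b)) →
      ε (q.1 b) b (q.2 b) ≠ 0 := by
    intro q b h
    rcases h with h | h | h
    · exact pres q A b h (epsA b)
    · exact pres q B b h (epsB b)
    · exact pres q C b h (epsC b)
  have hQ : ∀ j, j < 3 → termSign ε (Q j) ≠ 0 := by
    intro j hj
    interval_cases j
    · exact AtomBudget.termSign_ne_zero_of_cells ε qA fun b => presAll qA b (by
        rcases inc_cases b with ⟨h, -, -⟩ | ⟨h, -, -⟩ | ⟨h, -, -⟩ | ⟨h, -, -⟩ <;> simp only [h, true_or, or_true])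
    · exact AtomBudget.termSign_ne_zero_of_cells ε qB fun b => presAll qB b (by
        rcases inc_cases b with ⟨-, h, -⟩ | ⟨-, h, -⟩ | ⟨-, h, -⟩ | ⟨-, h, -⟩ <;> simp only [h, true_or, or_true])
    · exact AtomBudget.termSign_ne_zero_of_cells ε qC fun b => presAll qC b (by
        rcases inc_cases b with ⟨-, -, h⟩ | ⟨-, -, h⟩ | ⟨-, -, h⟩ | ⟨-, -, h⟩ <;> simp only [h, true_or, or_true])
  have hne : ∃ j, j < 3 ∧ Q j ≠ P j := by
    refine ⟨0, by norm_num, ?_⟩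
    rw [hQ0, hP0]; intro h; have h1 : qA.1 (t aa) = A.1 (t aa) := by rw [h]
    have h2 : qA.1 (t aa) = C.1 (t aa) := (Prod.mk.inj qA_aa).1
    rw [h2, ← hA1] at h1
    exact hal.symm (htinj.mp (A.1.injective h1))
  have hinc : ∀ (b : Fin m) (al : Fin m × Fin K),
      ((range 3).filter fun j => ((P j).1 b, (P j).2 b) = al).card =
        ((range 3).filter fun j => ((Q j).1 b, (Q j).2 b) = al).card := by
    intro b al
    rw [NoReturn.card_filter_range_three, NoReturn.card_filter_range_three]
    simp only [hP0, hP1, hP2, hQ0, hQ1, hQ2]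
    rcases inc_cases b with ⟨h1, h2, h3⟩ | ⟨h1, h2, h3⟩ | ⟨h1, h2, h3⟩ | ⟨h1, h2, h3⟩ <;>
      · (rw [h1, h2, h3]) <;> split_ifs <;> omega
  obtain ⟨j, hj, hlt⟩ := MultiExchange.prefix_deficit d v ε 3 θ P Q hθ hdom hQ hne hinc
  have hj2 : j < 2 := by omega
  -- slope bookkeeping
  have clA : ∀ b, (d (qA.2 b) : ℤ) - d (A.2 b) =
      if b = t aa then (d (C.2 (t aa)) : ℤ) - d (A.2 (t aa)) else if b = t ll then (d (B.2 (t ll)) : ℤ) - d (A.2 (t ll)) else 0 := by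
    intro b
    by_cases h1 : b = t aa
    · subst h1; simp [qA]
    · by_cases h2 : b = t ll
      · subst h2; simp [qA, h1]
      · simp [qA, h1, h2]
  have clAB : ∀ b, (d (qA.2 b) : ℤ) + d (qB.2 b) - d (A.2 b) - d (B.2 b) =
      if b ∈ Set.range t then (if b = t aa ∨ b = t ll then (d (C.2 b) : ℤ) - d (A.2 b) else (d (C.2 b) : ℤ) - d (B.2 b)) else 0 := by
    intro b
    by_cases hb : b ∈ Set.range t
    · rw [if_pos hb]
      by_cases h1 : b = t aa
      · subst h1
        have hn : t aa ∉ Set.range t' := by rintro ⟨j, hj⟩; exact t'_ne_aa j hj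
        simp [qA, qB, hn]; ring
      · by_cases h2 : b = t ll
        · subst h2
          have hy : t ll ∈ Set.range t' := ⟨Fin.last (k + 1), t'_last⟩
          simp [qA, qB, h1, hy]; ring
        · obtain ⟨i, rfl⟩ := hb
          have hi1 : i ≠ aa := fun h => h1 (by rw [h])
          have hi2 : i ≠ ll := fun h => h2 (by rw [h])
          have hiv : (i : ℕ) ≤ k := by
            have := i.isLt; have : (i : ℕ) ≠ k + 1 := fun h => hi1 (Fin.ext (by simp [haa_val, h]))
            have : (i : ℕ) ≠ k + 2 := fun h => hi2 (Fin.ext (by simp [hll_val, h])); omega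
          have hy : t i ∈ Set.range t' := ⟨⟨(i : ℕ), by omega⟩, by rw [t'_cast _ (by simp; omega)]⟩
          simp [qA, qB, h1, h2, hy]
    · rw [if_neg hb]
      have h1 : b ≠ t aa := fun h => hb ⟨aa, h.symm⟩
      have h2 : b ≠ t ll := fun h => hb ⟨ll, h.symm⟩
      have hb' : b ∉ Set.range t' := fun h => hb (range_t'_sub h)
      simp [qA, qB, h1, h2, hb']
  have sum_range : ∀ g : Fin m → ℤ, (∀ b, b ∉ Set.range t → g b = 0) → ∑ b, g b = ∑ i, g (t i) := by
    intro g hg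
    rw [← Finset.sum_image (f := g) (s := (univ : Finset (Fin (k + 3)))) (g := t) (fun i _ j _ h => ht h)]
    symm
    apply Finset.sum_subset (Finset.subset_univ _)
    intro b _ hb
    apply hg
    intro ⟨i, hi⟩
    exact hb (Finset.mem_image.mpr ⟨i, Finset.mem_univ _, hi⟩)
  interval_cases j
  · simp only [zero_add, Finset.sum_range_one, hP0, hQ0] at hlt
    have hdiff : ∑ b, ((d (qA.2 b) : ℤ) - d (A.2 b)) = (d (C.2 (t aa)) : ℤ) - d (A.2 (t aa)) + ((d (B.2 (t ll)) : ℤ) - d (A.2 (t ll))) := by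
      rw [sum_range _ (by
        intro b hb
        have h1 : b ≠ t aa := fun h => hb ⟨aa, h.symm⟩
        have h2 : b ≠ t ll := fun h => hb ⟨ll, h.symm⟩
        rw [clA, if_neg h1, if_neg h2])]
      simp_rw [clA]
      rw [← Finset.add_sum_erase _ _ (Finset.mem_univ aa), if_pos rfl,
        ← Finset.add_sum_erase _ _ (Finset.mem_erase.mpr ⟨hal.symm, Finset.mem_univ ll⟩)]
      have h : t ll ≠ t aa := fun h => hal (htinj.mp h).symm
      rw [if_neg h, if_pos rfl]
      rw [Finset.sum_eq_zero (fun i hi => ?_)]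
      · ring
      · obtain ⟨hi1, hi2⟩ : i ≠ ll ∧ i ≠ aa := by simpa [Finset.mem_erase] using hi
        rw [if_neg (fun h => hi2 (htinj.mp h)), if_neg (fun h => hi1 (htinj.mp h))]
    have : ∑ b, ((d (qA.2 b) : ℤ) - d (A.2 b)) > 0 := by
      rw [Finset.sum_sub_distrib]; linarith
    rw [hdiff] at this
    have heA' : (d (C.2 (t aa)) : ℤ) + d (B.2 (t ll)) ≤ d (A.2 (t aa)) + d (A.2 (t ll)) := by exact_mod_cast heA
    linarith
  · simp only [Finset.sum_range_succ, Finset.sum_range_zero, zero_add, hP0, hQ0, hP1, hQ1] at hlt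
    have hdiff : ∑ b, ((d (qA.2 b) : ℤ) + d (qB.2 b) - d (A.2 b) - d (B.2 b)) =
        ∑ i : Fin (k + 3), (if t i = t aa ∨ t i = t ll then (d (C.2 (t i)) : ℤ) - d (A.2 (t i)) else (d (C.2 (t i)) : ℤ) - d (B.2 (t i))) := by
      rw [sum_range _ (by intro b hb; rw [clAB, if_neg hb])]
      refine Finset.sum_congr rfl fun i _ => ?_
      rw [clAB, if_pos (memT i)]
    have hsplit : ∑ i : Fin (k + 3), (if t i = t aa ∨ t i = t ll then (d (C.2 (t i)) : ℤ) - d (A.2 (t i)) else (d (C.2 (t i)) : ℤ) - d (B.2 (t i)))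
        = ∑ i : Fin (k + 1), ((d (C.2 (t i.castSucc.castSucc)) : ℤ) - d (B.2 (t i.castSucc.castSucc)))
          + ((d (C.2 (t aa)) : ℤ) - d (A.2 (t aa))) + ((d (C.2 (t ll)) : ℤ) - d (A.2 (t ll))) := by
      rw [Fin.sum_univ_castSucc, Fin.sum_univ_castSucc, hll, haa]
      have e1 : ((Fin.last (k + 1)).castSucc : Fin (k + 3)) = aa := by rw [haa]
      congr 1
      congr 1
      · refine Finset.sum_congr rfl fun i _ => ?_
        have hne1 : t i.castSucc.castSucc ≠ t aa := by
          intro h; have := congrArg Fin.val (htinj.mp h); simp [haa_val] at this; omega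
        have hne2 : t i.castSucc.castSucc ≠ t (Fin.last (k + 2)) := by
          intro h; have := congrArg Fin.val (htinj.mp h); simp at this; omega
        rw [if_neg (by push Not; exact ⟨hne1, hne2⟩)]
      · rw [if_pos (Or.inl rfl)]
      · rw [if_pos (Or.inr rfl)]
    have hpos : ∑ b, ((d (qA.2 b) : ℤ) + d (qB.2 b) - d (A.2 b) - d (B.2 b)) > 0 := by
      have : ∑ b, ((d (qA.2 b) : ℤ) + d (qB.2 b) - d (A.2 b) - d (B.2 b)) =
          (∑ b, (d (qA.2 b) : ℤ)) + (∑ b, (d (qB.2 b) : ℤ)) - (∑ b, (d (A.2 b) : ℤ)) - ∑ b, (d (B.2 b) : ℤ) := by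
        simp only [Finset.sum_sub_distrib, Finset.sum_add_distrib]
      rw [this]; linarith
    rw [hdiff, hsplit] at hpos
    have hC : ∑ i : Fin (k + 3), (d (C.2 (t i)) : ℤ) =
        ∑ i : Fin (k + 1), (d (C.2 (t i.castSucc.castSucc)) : ℤ) + d (C.2 (t aa)) + d (C.2 (t ll)) := by
      rw [Fin.sum_univ_castSucc, Fin.sum_univ_castSucc, hll, haa]
    have heAB' : (∑ i : Fin (k + 3), (d (C.2 (t i)) : ℤ)) ≤
        (∑ i : Fin (k + 1), (d (B.2 (t i.castSucc.castSucc)) : ℤ)) + d (A.2 (t aa)) + d (A.2 (t ll)) := by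
      rw [hll, haa]; exact_mod_cast heAB
    rw [hC] at heAB'
    rw [Finset.sum_sub_distrib] at hpos
    linarith

end NoReturnEven

end Summit.ValiantsHypothesis.ValiantsHypothesis.Theorems.KPlusLogSqLaw
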